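import Summits.HubbardSuperconductivity.HubbardSuperconductivity.Theses.ChernVortexResponse
import Summits.HubbardSuperconductivity.HubbardSuperconductivity.Theorems.WeakCouplingBCSWcbcsThesis

/-!
# Route `ChernVortexResponse` — the glue items

Two bookkeeping items of route `ChernVortexResponse` (sub-problem `HubbardSuperconductivity`):

* `TargetOfCruxes` (stmt-HubbardSuperconductivity-14308): `HubbardVortexTension →
  TensionForcesCondensate → CondensateIsDWave → Target`, where `Target` is literally the
  conjunction of the three cruxes.
* `Assembly` (stmt-HubbardSuperconductivity-1196): `HubbardVortexTension → TensionForcesCondensate →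
  CondensateIsDWave → HubbardSuperconductivity`. The vortex tension supplies `U > 0`,
  `δ ∈ (0, 1/4) ⊂ (0, 1/2)` and the logarithmic tension; the two transfers then give
  `HasPairFieldLRO g_d` for every family of normalised sector ground states admissible at ALL
  sides; the tree's `hasDWavePairFieldLROAt_of_forall_hasPairFieldLRO` (fill the odd sides with
  sector ground states, pass the positive `liminf` to the even subsequence under the a-priori
  cap) turns this into the summit's even-side matrix at `(U, δ)`.

Sources: D. J. Scalapino, Phys. Rep. 250 (1995) 329, §2 eq. (2.4); C. N. Yang, Rev. Mod. Phys. 34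
(1962) 694, §4. No new definitions.
-/

-- the mandated namespace `Summit.<Summit>.<Problem>.Theorems` repeats `HubbardSuperconductivity`
-- (single-problem summit, D-0017), which the `dupNamespace` linter flags on every declaration
set_option linter.dupNamespace false

namespace Summit.HubbardSuperconductivity.HubbardSuperconductivity.Theorems.ChernVortexResponse

open Matrix Literature.MathematicalPhysics.QuantumLattice
open Summit.HubbardSuperconductivity.HubbardSuperconductivity.Theses.ChernVortexResponse
open Summit.HubbardSuperconductivity.HubbardSuperconductivity.Theorems
  (hasDWavePairFieldLROAt_of_forall_hasPairFieldLRO)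

/-- **`TargetOfCruxes`** (stmt-HubbardSuperconductivity-14308): the three cruxes give the route's
`Target`, which is their conjunction. Scalapino, Phys. Rep. 250 (1995) 329, §2. [folklore] -/
theorem targetOfCruxes_proof :
    Summit.HubbardSuperconductivity.HubbardSuperconductivity.Theses.ChernVortexResponse.TargetOfCruxes := by
  unfold TargetOfCruxes Target
  intro hV hT hC
  exact ⟨hV, hT, hC⟩

/-- **Assembly of route `ChernVortexResponse`** (stmt-HubbardSuperconductivity-1196):
`HubbardVortexTension → TensionForcesCondensate → CondensateIsDWave → HubbardSuperconductivity`.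
With `(U, δ)` and the logarithmic vortex tension from `HubbardVortexTension` (`δ < 1/4 < 1/2`),
every all-sides-admissible family of normalised sector ground states has Yang ODLRO
(`TensionForcesCondensate`) and hence `d_{x²-y²}` pair-field LRO (`CondensateIsDWave`); the
odd-side filling / even-subsequence bookkeeping `hasDWavePairFieldLROAt_of_forall_hasPairFieldLRO`
gives the summit's matrix at `(U, δ)`. Scalapino, Phys. Rep. 250 (1995) 329, §2 eq. (2.4);
Yang, Rev. Mod. Phys. 34 (1962) 694, §4. [folklore] -/
theorem chernVortexResponse_assembly_proof :
    Summit.HubbardSuperconductivity.HubbardSuperconductivity.Theses.ChernVortexResponse.Assembly := by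
  unfold Assembly HubbardVortexTension TensionForcesCondensate CondensateIsDWave
  rintro ⟨U, hU, δ, hδ, hten⟩ hT hC
  have hδ' : δ ∈ Set.Ioo (0 : ℝ) (1 / 2) := ⟨hδ.1, by linarith [hδ.2]⟩
  unfold _root_.HubbardSuperconductivity Literature.Hubbard.DWaveSuperconductivityHubbard
  refine ⟨U, hU, δ, hδ', ?_⟩
  exact hasDWavePairFieldLROAt_of_forall_hasPairFieldLRO (by linarith [hδ.1])
    (fun N ψ hadm => hC U δ hU hδ hten N ψ hadm (hT U δ hU hδ' hten N ψ hadm))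

end Summit.HubbardSuperconductivity.HubbardSuperconductivity.Theorems.ChernVortexResponse
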